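import Mathlib
import HarnessLib
import Summits.Ventures.LatticeQCDFlow.Exactness.SphereLuscherSeriesLocalityES
import Summits.Ventures.LatticeQCDFlow.Exactness.LatticeSiteLocalDimension

/-!
# Coefficient count of Lüscher's local flow-action terms on the lattice of site spheres: bounded by the order, the target dimension and the coordination number — not by the volume

HONEST FRAMING: exact (Metropolis-corrected) sampling algorithms for lattice gauge theory;
figures of merit are autocorrelation/cost numbers at stated couplings and volumes; no
continuum-physics claim.

Venture `LatticeQCDFlow` (cell pub-lqcd), topic `Exactness`; FANOUT row 7 (`s0-cpn-null`).  NEW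
WORK of the cell over Mathlib (`Set.ncard`) and the tree's `Exactness/SphereLuscherSeriesLocality.lean`
(`nball`), `Exactness/SphereLuscherSeriesLocalityES.lean` (`exists_local_luscher_series_esAction`:
`X_n⁽ᵏ⁾ ∈ polySD (2(k+1)) (nball (couplingNbhd U) (k+1) n)`) and
`Exactness/LatticeSiteLocalDimension.lean` (`finrank_polySD_le_sum`:
`dim polySD N A ≤ Σ_{j≤N} (|A|·d)^j`); nothing is cited as a fact.  Printed counterpart, NAMED ONLY:
M. Lüscher, Commun. Math. Phys. 293 (2010) 899, §4.4–§4.5 (at each order the flow action is a finite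
combination of local terms, determined by finitely many coefficients per site, uniformly in the
lattice size).  Relevant to the cell's theory question (SCOPING §theory pair: "how the required
network size must scale with VOLUME"): at fixed perturbative order the answer typed here is — not
at all, per site.

## Content (`Λ` finite; `N : Λ → Set Λ` a neighbourhood structure with at most `Δ` neighbours per site)

* **`ncard_nball_le`** — `|nball N r n| ≤ (Δ+1)^r` (ball growth in a structure of coordination
  number `≤ Δ`).
* **`finrank_polySD_nball_le`** — `dim polySD M (nball N r n) ≤ Σ_{j ≤ M} ((Δ+1)^r · d)^j`.
* **`luscher_coefficient_count_esAction`** — for E–S couplings with at most `Δ` partners per site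
  (no self-coupling, adjoint pairs; `dim E = d ≥ 2`): the order-`k` local terms `X_n⁽ᵏ⁾` of
  `exists_local_luscher_series_esAction` lie, for EVERY anchor `n`, in a space of real dimension
  `≤ Σ_{j ≤ 2(k+1)} ((Δ+1)^{k+1} · d)^j` — A BOUND BY THE ORDER, THE TARGET DIMENSION AND THE
  COORDINATION NUMBER ONLY, INDEPENDENT OF `|Λ|`.

NOT CLAIMED: sharpness (neither the monomial count nor the ball growth is optimal; on `ℤ²` balls grow
quadratically, not exponentially); anything at `t > 0`; anything quantitative beyond the count.
-/

noncomputable section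

namespace Summit.Ventures.LatticeQCDFlow.Exactness

open Function Set
open scoped RealInnerProductSpace

variable {Λ : Type*}

/-! ## §1 Ball growth under a coordination bound -/

section BallGrowth

variable [Finite Λ] {N : Λ → Set Λ} {Δ : ℕ}

/-- One step of ball growth: `|nball (r+1) n| ≤ (Δ+1)·|nball r n|` when every site has at most `Δ`
neighbours. -/
theorem ncard_nball_succ_le (hΔ : ∀ m, (N m).ncard ≤ Δ) (r : ℕ) (n : Λ) :
    (nball N (r + 1) n).ncard ≤ (Δ + 1) * (nball N r n).ncard := by
  classical
  set T := (toFinite (nball N r n)).toFinset with hT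
  have hU : (⋃ m ∈ nball N r n, N m) = ⋃ m ∈ T, N m := by
    ext m'; simp [hT, Finite.mem_toFinset]
  have hcard : T.card = (nball N r n).ncard := (ncard_eq_toFinset_card _ _).symm
  calc (nball N (r + 1) n).ncard
      ≤ (nball N r n).ncard + (⋃ m ∈ nball N r n, N m).ncard := ncard_union_le _ _
    _ ≤ (nball N r n).ncard + ∑ m ∈ T, (N m).ncard := by
        rw [hU]; exact Nat.add_le_add_left (Finset.set_ncard_biUnion_le T N) _
    _ ≤ (nball N r n).ncard + T.card * Δ := by
        refine Nat.add_le_add_left ?_ _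
        have h := Finset.sum_le_card_nsmul T (fun m => (N m).ncard) Δ fun m _ => hΔ m
        simpa using h
    _ = (Δ + 1) * (nball N r n).ncard := by rw [hcard]; ring

/-- **Ball growth**: `|nball N r n| ≤ (Δ+1)^r` when every site has at most `Δ` neighbours. -/
theorem ncard_nball_le (hΔ : ∀ m, (N m).ncard ≤ Δ) (n : Λ) :
    ∀ r, (nball N r n).ncard ≤ (Δ + 1) ^ r
  | 0 => by simp [nball]
  | r + 1 => (ncard_nball_succ_le hΔ r n).trans (by
      rw [pow_succ, mul_comm ((Δ + 1) ^ r)]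
      exact Nat.mul_le_mul_left _ (ncard_nball_le hΔ n r))

end BallGrowth

/-! ## §2 The coefficient count -/

section Count

variable {E : Type*} [NormedAddCommGroup E] [InnerProductSpace ℝ E] [FiniteDimensional ℝ E]
variable [Fintype Λ] {N : Λ → Set Λ} {Δ : ℕ}

/-- **`dim polySD M (nball N r n) ≤ Σ_{j ≤ M} ((Δ+1)^r · d)^j`** under a coordination bound `Δ`. -/
theorem finrank_polySD_nball_le (hΔ : ∀ m, (N m).ncard ≤ Δ) (M r : ℕ) (n : Λ) :
    Module.finrank ℝ (polySD Λ E M (nball N r n)) ≤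
      ∑ j ∈ Finset.range (M + 1), ((Δ + 1) ^ r * Module.finrank ℝ E) ^ j := by
  classical
  haveI : Fintype (nball N r n) := Fintype.ofFinite _
  refine (finrank_polySD_le_sum M (nball N r n)).trans (Finset.sum_le_sum fun j _ => ?_)
  refine Nat.pow_le_pow_left (Nat.mul_le_mul_right _ ?_) j
  rw [← Nat.card_eq_fintype_card, Nat.card_coe_set_eq]
  exact ncard_nball_le hΔ n r

variable [MeasurableSpace E] [BorelSpace E] [DecidableEq Λ] [Nonempty Λ] {U : Λ → Λ → (E →L[ℝ] E)}

/-- **THE COEFFICIENT COUNT OF LÜSCHER'S LOCAL TERMS FOR THE ENGEL–SCHAEFER ACTION IS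
VOLUME-INDEPENDENT.**  For E–S couplings with at most `Δ` partners per site (no self-coupling,
adjoint pairs; `dim E ≥ 2`) there are local terms `X_n⁽ᵏ⁾` and constants `ċ_k` solving Lüscher's
recursion as in `exists_local_luscher_series_esAction`, and for every order `k` and anchor `n` the
term `X_n⁽ᵏ⁾` lies in a space of lattice polynomials (degree `≤ 2(k+1)`, supported in the
radius-`(k+1)` coupling ball) of real dimension `≤ Σ_{j ≤ 2(k+1)} ((Δ+1)^{k+1} · dim E)^j`. -/
theorem luscher_coefficient_count_esAction (h2 : 2 ≤ Module.finrank ℝ E) (hU0 : ∀ n, U n n = 0)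
    (hUadj : ∀ m n (v w : E), ⟪U m n v, w⟫ = ⟪v, U n m w⟫) (hΔ : ∀ m, (couplingNbhd U m).ncard ≤ Δ)
    (κ S₀ : ℝ) :
    ∃ (X : ℕ → Λ → (Λ → E) → ℝ) (c : ℕ → ℝ),
      (∀ k n, X k n ∈ polySD Λ E (2 * (k + 1)) (nball (couplingNbhd U) (k + 1) n)) ∧
      (∀ k n, Module.finrank ℝ (polySD Λ E (2 * (k + 1)) (nball (couplingNbhd U) (k + 1) n)) ≤
        ∑ j ∈ Finset.range (2 * (k + 1) + 1), ((Δ + 1) ^ (k + 1) * Module.finrank ℝ E) ^ j) ∧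
      (∀ ξ : Λ → Metric.sphere (0 : E) 1,
        -∑ j, siteLaplacian j (fun x => ∑ n, X 0 n x) (fun m => (ξ m : E)) =
          esAction κ S₀ U (fun m => (ξ m : E)) + c 0) ∧
      (∀ k, ∀ ξ : Λ → Metric.sphere (0 : E) 1,
        -∑ j, siteLaplacian j (fun x => ∑ n, X (k + 1) n x) (fun m => (ξ m : E)) =
          -(∑ j, ⟪siteGrad j (esAction κ S₀ U) (fun m => (ξ m : E)),
              siteGrad j (fun x => ∑ n, X k n x) (fun m => (ξ m : E))⟫) + c (k + 1)) := by
  obtain ⟨X, c, hmem, h0, hs⟩ := exists_local_luscher_series_esAction h2 hU0 hUadj κ S₀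
  exact ⟨X, c, hmem, fun k n => finrank_polySD_nball_le hΔ _ _ n, h0, hs⟩

end Count

end Summit.Ventures.LatticeQCDFlow.Exactness

end
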